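import Summits.QuantumFields.YangMills.Theorems.UnitScaleTiltProp7FirstVariationExactPairing
import Summits.QuantumFields.YangMills.Theorems.UnitScaleTiltProp7CurvedLandauRowE
import Summits.QuantumFields.YangMills.Theorems.UnitScaleTiltProp7FibreLevelSupRowsT3
import Summits.QuantumFields.YangMills.Theorems.UnitScaleTiltProp7HessWOfFibreCoreT3Rows
import Summits.QuantumFields.YangMills.Theorems.UnitScaleTiltProp7TrueLinRealityFamilies
import HarnessLib

/-!
# Route `UnitScaleTilt`, crux K1 «MinimiserStabilityRegPr» (stmt-QuantumFields-19200), (n3)∕E′∕EX growth side, file F5a —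
# TOWER DATA OF A CHART POINT `e^{iD}W` OVER A (14)-REGULAR BACKGROUND `W`: geometric level sizes and the `ℓ¹` amplification factor `≤ 3∕2`,
# per-level sups ∕ two-block masses of the ratio tower with their numerals, and the `𝔰𝔲(2)` rows of the log-ratio tower and of its sources

Cell `ym3-torus`, width seat `ym-ust-19200-w4` (gen 5); ★p1-19200 g14's NAMED file F5 («w4: GO (o4)» 2026-08-28 15:58Z), first half.  THEOREMS ONLY (0 `def`, 0 `sorry`);
`--supports stmt-QuantumFields-19200`, count-neutral.  YM₃ on T³ is a ladder rung (R3), not the Clay problem; nothing here claims the stub, E′, the crux, d = 4 or the gap.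

THE POINT.  The JOINT-mod-coarse-gauge conjunct of the growth-side doors (✓ `Prop7LocMinOfGaugedRows116.isMinOn_regFibrePr_of_fibreRows_at`, ✓ `Prop7HcoWOfGaugedRows.hcoW_of_gaugedRowsW`)
is discharged in the sequel ✓∕⧗ `Prop7JointRowOfSuppliers` from the landed (n3) theorems (F2 ✓ `Prop7FibreLogRatioGaugedL1`, F3 ✓ `Prop7LogRemainderMass`, F4b
✓ `Prop7FibreLevelMassPerLevelT3`, F4 ✓ `Prop7JointRowOfLevelMasses`, F0 ✓ `Prop7TrueLinRealityFamilies`).  Those theorems carry per-level GUARDS; this file supplies them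
at the datum «`W ∈ 𝔘_k(e)`, `D` Hermitian traceless with `‖D(b)‖ ≤ s`, windows `10¹⁴L⁹e ≤ 1`, `4·10¹¹L⁹(ℓs) ≤ 1` (`ℓ = L^{K−n}`)», k-UNIFORMLY:
* §1 `levelSizes_of_regPr` — the (0.4)-loop variables of `W̄^{(j)}` are within `a_j = ((d+2)L)²∕2·e·L^{2j}∕L^{2(K−n)}` of `1` (✓ `Prop7CurvedLandauRowE.loop_size_geom` under
  the scaled plaquette bound of `RegPr`), `a_j ≤ 1∕24 < δ`, and — the one place where the CRUDE constant profile of ✓ `tower_loop_rows_of_regPr` would cost `exp(c·k·e)` —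
  F2's amplification factor `exp((159(d+2)L·2d∕(L^{−d}L))·Σ_{i<K−n}a_i) ≤ 3∕2` from `Σ_{i<k}L^{2i}∕L^{2k} ≤ 1∕3` (exponent `19875·L⁵·e ≤ 1∕3`).
* §2 `chartSups` — `‖Y_j(b)‖ ≤ 16Lʲs` (`j ≤ K − n`) and the two-block masses `(d+2)L·Σ_{N(c)}‖Y_j‖ ≤ 480L⁴Lʲs` (`j < K − n`) for `Y_j = pertVar W̄^{(j)} (e^{iD}W)‾^{(j)}`
  (✓ `Prop7FibreLevelSupRowsT3` at `ρ = 2s`, `δ = regThreshold(e)`; the number `2·10¹⁴L·4Lʲ(2s + 2X·δ) ≤ 1` from `4·10¹¹·6561·L(ℓs) ≤ 1` and `10¹⁴·2187·L²e ≤ 1`).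
* §3 `supNumerals` (the `hμ72 ∕ hμN ∕ hμθ ∕ hθL` binders of F4b with `μ_j = 480L⁴Lʲs`, `θ = 3744000L⁷(ℓs)`; `16Lʲs < 1∕3`) and `suRows` (log-ratios `X_j`, sources
  `R_j = X_{j+1} − T_jX_j` and `X_0 − iD` are skew-Hermitian traceless: ✓ `su_mlog_pertVar_add_one`, ✓ `su_trueLin`, ✓ `su_sub`).
HONEST SCOPE.  Bookkeeping over landed letters and numerals; nothing of Bałaban's analysis is asserted.

References: T. Bałaban, CMP 102 (1985) 277–309 [Balaban1985Variational] ((14)–(15) p.280, (112) p.294); CMP 98 (1985) 17–51 [Balaban1985Averaging] ((19)–(23) p.21, Prop. 3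
(122)–(126) p.36, Prop. 4 (134)–(135) p.38); CMP 95 (1984) 17–40 [Balaban1984PropagatorsI] ((1.18)–(1.20) pp.19–20); CMP 99 (1985) 389–434 [Balaban1985BackgroundPropagators]
(Thm 3.11 p.416).
-/

set_option autoImplicit false

noncomputable section

open scoped BigOperators Matrix.Norms.L2Operator Matrix

namespace Summit.QuantumFields.YangMills.Theorems.Prop7JointRowTowerData

open Literature.MathematicalPhysics.QuantumFieldTheory.Balaban1983to89
open Literature.MathematicalPhysics.QuantumFieldTheory.Balaban1983to89.T3ContinuumYM3Torus
open Literature.MathematicalPhysics.QuantumFieldTheory.Balaban1983to89.T3RegularMinimiser (regThreshold)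
open Literature.MathematicalPhysics.QuantumFieldTheory.Balaban1983to89.T3PrintedRegularMinimiser (RegPr)
open Literature.MathematicalPhysics.QuantumFieldTheory.Balaban1983to89.T3SectALandauChart (emb15)
open Finset T4Continuum BlockAveraging AveragingRT ExpMeanLog BlockAveragingEMLLinearised BlockAveragingEMLLinearisedBackground BlockAveragingEMLProp2
open MatrixLog (mlog)
open Summit.QuantumFields.YangMills.Theorems.Prop7TPrint (expHermField)
open Summit.QuantumFields.YangMills.Theorems.Prop7CurvedLandauKnitT3 (smallness_T3 three_le_L)
open Summit.QuantumFields.YangMills.Theorems.Prop7CurvedLandauRowE (loop_size_geom sum_range_pow_div_le_third exp_third_le)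

/-! ## §1 Level sizes of the (0.4)-loop variables along a (14)-regular tower, geometric profile; the G-channel amplification factor -/

set_option maxHeartbeats 400000 in
/-- **LEVEL SIZES, GEOMETRIC PROFILE.**  For `W ∈ 𝔘_k(e)` (`RegPr`, `10⁶L⁵e ≤ 1`) the (0.4)-loop variables of the `j`-th averaged field are within
`a_j := ((d+2)L)²∕2 · e · L^{2j}∕L^{2(K−n)}` of `1` for every `j < K − n` (✓ `Prop7CurvedLandauRowE.loop_size_geom` under the scaled plaquette bound of `RegPr`);
`0 ≤ a_j ≤ 1∕24`, `a_j < δ_{SU(2)}`, and the G-channel amplification factor of ✓ `Prop7FibreLogRatioGaugedL1` obeys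
`exp((159(d+2)L·2d ∕ (L^{−d}·L))·Σ_{i<K−n} a_i) ≤ 3∕2` — k-UNIFORMLY (the sizes are summable from the top: `Σ_{i<k}L^{2i}∕L^{2k} ≤ 1∕3`).
[cite: Balaban1985Variational, (14)-(15) p.280; Balaban1985Averaging, (19)-(23) p.21; Balaban1984PropagatorsI, (1.18)-(1.20) pp.19-20] -/
theorem levelSizes_of_regPr (F : T3Family) (n K : ℕ) {e : ℝ} (he : 0 < e) (heL : 1000000 * (F.L : ℝ) ^ 5 * e ≤ 1)
    {W : GaugeField (F.P K) 0 (Matrix.specialUnitaryGroup (Fin 2) ℂ)} (hreg : RegPr F n K e W) :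
    (∀ j < K - n, ∀ (c : PBond (F.P K) (j + 1)) (i : Idx (F.P K)),
        dist1 (loopHol (Averaging.iter (fun i => blockAvg (P := F.P K) (j := i) (expMeanLogSU (n := Fin 2))) j W) c i)
          ≤ (fun j : ℕ => ((((F.P K).d + 2) * (F.P K).L : ℕ) : ℝ) ^ 2 / 2 * e * ((((F.P K).L : ℝ)) ^ (2 * j) / (((F.P K).L : ℝ)) ^ (2 * (K - n)))) j) ∧
    (∀ j, 0 ≤ (fun j : ℕ => ((((F.P K).d + 2) * (F.P K).L : ℕ) : ℝ) ^ 2 / 2 * e * ((((F.P K).L : ℝ)) ^ (2 * j) / (((F.P K).L : ℝ)) ^ (2 * (K - n)))) j) ∧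
    (∀ j < K - n, (fun j : ℕ => ((((F.P K).d + 2) * (F.P K).L : ℕ) : ℝ) ^ 2 / 2 * e * ((((F.P K).L : ℝ)) ^ (2 * j) / (((F.P K).L : ℝ)) ^ (2 * (K - n)))) j ≤ 1 / 24) ∧
    (∀ j < K - n, (fun j : ℕ => ((((F.P K).d + 2) * (F.P K).L : ℕ) : ℝ) ^ 2 / 2 * e * ((((F.P K).L : ℝ)) ^ (2 * j) / (((F.P K).L : ℝ)) ^ (2 * (K - n)))) j < deltaSU (Fin 2)) ∧
    Real.exp ((159 * ((((F.P K).d + 2) * (F.P K).L : ℕ) : ℝ) * (2 * (F.P K).d)) / ((((F.P K).L : ℝ) ^ (F.P K).d)⁻¹ * ((F.P K).L : ℝ))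
        * ∑ i ∈ Finset.range (K - n), (fun j : ℕ => ((((F.P K).d + 2) * (F.P K).L : ℕ) : ℝ) ^ 2 / 2 * e * ((((F.P K).L : ℝ)) ^ (2 * j) / (((F.P K).L : ℝ)) ^ (2 * (K - n)))) i) ≤ 3 / 2 := by
  have hL3 : (3 : ℝ) ≤ (F.L : ℝ) := three_le_L F
  have hPL : ((F.P K).L : ℝ) = F.L := rfl
  have hd : (F.P K).d = 3 := T3Family.P_d F K
  have hL0 : (0 : ℝ) < (F.L : ℝ) := by linarith
  have hδ : deltaSU (Fin 2) = 1 / 3 := by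
    unfold deltaSU
    rw [Fintype.card_fin]
    refine min_eq_left ?_
    rw [le_div_iff₀ (by norm_num)]
    have := Real.pi_gt_three; push_cast; linarith
  obtain ⟨-, hε3', hε2', h12, -⟩ := smallness_T3 F K he heL
  have hε3 : (143 * (((((F.P K).d + 4 : ℕ) : ℝ)) ^ 2 / 4) ^ 2) * e ≤ 1 / 3 := by
    have h0 : 0 ≤ (143 * (((((F.P K).d + 4 : ℕ) : ℝ)) ^ 2 / 4) ^ 2) * e := by positivity
    nlinarith
  have hε2 : 2 * e ≤ 2 * deltaSU (Fin 2) / ((((F.P K).d + 4) * (F.P K).L : ℕ) : ℝ) ^ 2 := by nlinarith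
  -- the scaled plaquette bound of `RegPr`
  have hU : PlaqSmall (e * ((((F.P K).L : ℝ) ^ (K - n))⁻¹) ^ 2) W := by
    intro q
    have h1 := hreg.plaqSmall q
    have h2 : regThreshold F n K e = e * ((((F.P K).L : ℝ) ^ (K - n))⁻¹) ^ 2 := by
      rw [regThreshold, hPL, inv_pow, inv_pow, mul_comm 2 (K - n), pow_mul]
    rwa [h2] at h1
  -- the profile at `j < K − n` is at most its top value `((d+2)L)²/2 · e`
  have htop : ∀ j < K - n, ((((F.P K).d + 2) * (F.P K).L : ℕ) : ℝ) ^ 2 / 2 * e * ((((F.P K).L : ℝ)) ^ (2 * j) / (((F.P K).L : ℝ)) ^ (2 * (K - n)))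
      ≤ ((((F.P K).d + 2) * (F.P K).L : ℕ) : ℝ) ^ 2 / 2 * e := by
    intro j hj
    have hx1 : (((F.P K).L : ℝ)) ^ (2 * j) / (((F.P K).L : ℝ)) ^ (2 * (K - n)) ≤ 1 := by
      rw [hPL, div_le_one (by positivity)]
      exact pow_le_pow_right₀ (by linarith) (by omega)
    exact mul_le_of_le_one_right (by positivity) hx1
  have htopval : ((((F.P K).d + 2) * (F.P K).L : ℕ) : ℝ) ^ 2 / 2 * e ≤ 1 / 48 := by linarith
  refine ⟨fun j hj c i => loop_size_geom (K - n) he hε3 hε2 hU j hj c i, fun j => by positivity, fun j hj => (htop j hj).trans (by linarith),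
    fun j hj => ?_, ?_⟩
  · rw [hδ]; exact (htop j hj).trans_lt (by linarith)
  · -- the amplification factor: exponent `≤ (159·5L·6)·L²·((5L)²/2·e/3) = 19875·L⁵·e ≤ 1/3`
    refine (Real.exp_le_exp.2 ?_).trans exp_third_le
    have hL2 : (2 : ℝ) ≤ ((F.P K).L : ℝ) := by rw [hPL]; linarith
    have hS : ∑ i ∈ Finset.range (K - n), ((((F.P K).d + 2) * (F.P K).L : ℕ) : ℝ) ^ 2 / 2 * e * ((((F.P K).L : ℝ)) ^ (2 * i) / (((F.P K).L : ℝ)) ^ (2 * (K - n)))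
        ≤ ((((F.P K).d + 2) * (F.P K).L : ℕ) : ℝ) ^ 2 / 2 * e / 3 := by
      rw [← Finset.mul_sum]
      have := sum_range_pow_div_le_third hL2 (K - n)
      have h0 : 0 ≤ ((((F.P K).d + 2) * (F.P K).L : ℕ) : ℝ) ^ 2 / 2 * e := by positivity
      nlinarith
    have hpre0 : 0 ≤ (159 * ((((F.P K).d + 2) * (F.P K).L : ℕ) : ℝ) * (2 * (F.P K).d)) / ((((F.P K).L : ℝ) ^ (F.P K).d)⁻¹ * ((F.P K).L : ℝ)) := by
      positivity
    refine (mul_le_mul_of_nonneg_left hS hpre0).trans ?_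
    have heq : (159 * ((((F.P K).d + 2) * (F.P K).L : ℕ) : ℝ) * (2 * (F.P K).d)) / ((((F.P K).L : ℝ) ^ (F.P K).d)⁻¹ * ((F.P K).L : ℝ))
        * (((((F.P K).d + 2) * (F.P K).L : ℕ) : ℝ) ^ 2 / 2 * e / 3) = 19875 * (F.L : ℝ) ^ 5 * e := by
      rw [hd]; push_cast; rw [hPL]; field_simp; ring
    rw [heq]
    have hL5 : 0 ≤ (F.L : ℝ) ^ 5 := by positivity
    nlinarith


/-! ## §2 Sup rows of the ratio tower of the chart point `e^{iD}W` against `W` -/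

set_option maxHeartbeats 400000 in
/-- **PER-LEVEL SUPS OF THE RATIO TOWER AT A CHART POINT.**  `W ∈ 𝔘_k(e)`, `D` Hermitian traceless with `‖D(b)‖ ≤ s`, `4s ≤ 1`, windows `10¹⁴L⁹e ≤ 1`,
`4·10¹¹L⁹(ℓs) ≤ 1` (`ℓ = L^{K−n}`), `W′ = e^{iD}W` (`emb15 W (expHermField D)`; bondwise `‖W′(b) − W(b)‖ ≤ 2‖D(b)‖ ≤ 2s`, ✓ `norm_expChart_sub_le`).  Then for the level
ratios `Y_j = pertVar W̄^{(j)} W̄′^{(j)}`: (i) `‖Y_j(b)‖ ≤ 16·Lʲ·s` for every `j ≤ K − n` (✓ `norm_pertVar_iter_le_of_plaqBound_T3` at `ρ = 2s`, `δ = regThreshold(e)`);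
(ii) the two-block neighbourhood masses `(d+2)L·Σ_{b∈N(c)}‖Y_j(b)‖ ≤ 480·L⁴·Lʲ·s` for every `j < K − n` (✓ `twoBlockMass_le_of_plaqBound_T3`, `mu_letter_T3`) — the `hμ`
binder of ✓ `Prop7LogRemainderMass.sum_norm_logRemainder_le_mass` and of ✓ `Prop7FibreLevelMassPerLevelT3.sum_normSq_levelRatio_le_LOnly_T3`.
[cite: Balaban1985Averaging, Prop. 4 (134)-(135) p.38; Balaban1985Variational, (14)-(15) p.280] -/
theorem chartSups (F : T3Family) (n K : ℕ) {e s : ℝ} (he : 0 < e) (heL : 100000000000000 * (F.L : ℝ) ^ 9 * e ≤ 1)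
    (hs0 : 0 ≤ s) (hs4 : 4 * s ≤ 1) (hsL : 400000000000 * (F.L : ℝ) ^ 9 * (((F.L : ℝ) ^ (K - n)) * s) ≤ 1)
    {W : GaugeField (F.P K) 0 (Matrix.specialUnitaryGroup (Fin 2) ℂ)} (hreg : RegPr F n K e W)
    (D : PBond (F.P K) 0 → Matrix (Fin 2) (Fin 2) ℂ) (hD : ∀ b : PBond (F.P K) 0, (D b).IsHermitian ∧ Matrix.trace (D b) = 0)
    (hs : ∀ b : PBond (F.P K) 0, ‖D b‖ ≤ s) :
    (∀ j ≤ K - n, ∀ b : PBond (F.P K) j,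
        ‖pertVar (Averaging.iter (fun i => blockAvg (P := F.P K) (j := i) (expMeanLogSU (n := Fin 2))) j W)
            (Averaging.iter (fun i => blockAvg (P := F.P K) (j := i) (expMeanLogSU (n := Fin 2))) j (emb15 W (expHermField D))) b‖
          ≤ 16 * (F.L : ℝ) ^ j * s) ∧
    (∀ j < K - n, ∀ c : PBond (F.P K) (j + 1),
        ((((F.P K).d + 2) * (F.P K).L : ℕ) : ℝ) * ∑ b ∈ (univ.filter (fun b : PBond (F.P K) j => blockOf b.src = c.src ∨ blockOf b.src = c.tgt)),
            ‖(pertVar (Averaging.iter (fun i => blockAvg (P := F.P K) (j := i) (expMeanLogSU (n := Fin 2))) j W)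
                (Averaging.iter (fun i => blockAvg (P := F.P K) (j := i) (expMeanLogSU (n := Fin 2))) j (emb15 W (expHermField D)))) b‖
          ≤ 480 * (F.L : ℝ) ^ 4 * (F.L : ℝ) ^ j * s) := by
  have hL3 : (3 : ℝ) ≤ (F.L : ℝ) := three_le_L F
  have hPL : ((F.P K).L : ℝ) = F.L := rfl
  have hd : (F.P K).d = 3 := T3Family.P_d F K
  have hL0 : (0 : ℝ) < (F.L : ℝ) := by linarith
  have hL1 : (1 : ℝ) ≤ (F.L : ℝ) := by linarith
  have hm := F.hm
  -- scalar windows: `L⁸ ≥ 6561`, `L⁷ ≥ 2187`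
  have hL8 : (6561 : ℝ) ≤ (F.L : ℝ) ^ 8 := by
    have := pow_le_pow_left₀ (by norm_num : (0:ℝ) ≤ 3) hL3 8
    norm_num at this; exact this
  have hL7 : (2187 : ℝ) ≤ (F.L : ℝ) ^ 7 := by
    have := pow_le_pow_left₀ (by norm_num : (0:ℝ) ≤ 3) hL3 7
    norm_num at this; exact this
  have hℓ1 : (1 : ℝ) ≤ (F.L : ℝ) ^ (K - n) := one_le_pow₀ hL1
  have hLℓs0 : 0 ≤ (F.L : ℝ) * (((F.L : ℝ) ^ (K - n)) * s) := by positivity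
  have hA : 4 * 10 ^ 11 * 6561 * ((F.L : ℝ) * (((F.L : ℝ) ^ (K - n)) * s)) ≤ 1 := by
    have h9 : (F.L : ℝ) ^ 9 * (((F.L : ℝ) ^ (K - n)) * s) = (F.L : ℝ) ^ 8 * ((F.L : ℝ) * (((F.L : ℝ) ^ (K - n)) * s)) := by ring
    rw [mul_assoc, h9] at hsL
    nlinarith [mul_le_mul_of_nonneg_right hL8 hLℓs0]
  have hL2e0 : 0 ≤ (F.L : ℝ) ^ 2 * e := by positivity
  have hB : 10 ^ 14 * 2187 * ((F.L : ℝ) ^ 2 * e) ≤ 1 := by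
    have h9 : (F.L : ℝ) ^ 9 * e = (F.L : ℝ) ^ 7 * ((F.L : ℝ) ^ 2 * e) := by ring
    rw [mul_assoc, h9] at heL
    nlinarith [mul_le_mul_of_nonneg_right hL7 hL2e0]
  have hρ0 : (0 : ℝ) ≤ 2 * s := by positivity
  have hδ0 : 0 ≤ regThreshold F n K e := (T3RegularMinimiser.regThreshold_pos F he).le
  have hreg' : regThreshold F n K e = e * ((((F.L : ℝ)) ^ (K - n))⁻¹) ^ 2 := by
    rw [regThreshold, inv_pow, inv_pow, mul_comm 2 (K - n), pow_mul]
  -- the two bondwise inputs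
  have hU : ∀ p : Plaq (F.P K) 0, dist1 (GaugeField.plaqHol W p) ≤ regThreshold F n K e := fun p => (hreg.plaqSmall p).le
  have hρ : ∀ b : PBond (F.P K) 0, ‖((emb15 W (expHermField D) b : Matrix.specialUnitaryGroup (Fin 2) ℂ) : Matrix (Fin 2) (Fin 2) ℂ)
      - ((W b : Matrix.specialUnitaryGroup (Fin 2) ℂ) : Matrix (Fin 2) (Fin 2) ℂ)‖ ≤ 2 * s := fun b =>
    (Prop7HessWOfFibreCoreT3Rows.norm_expChart_sub_le W D b (hD b) ((hs b).trans (by linarith))).trans (by linarith [hs b])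
  -- the "number" of the sup theorems: `2·10¹⁴·L·(4Lʲ(2s + 2·X·regThreshold)) ≤ 1` for `0 ≤ X ≤ 3L^{j+1}`, `j ≤ K − n`
  have hnum : ∀ j ≤ K - n, ∀ X : ℝ, 0 ≤ X → X ≤ 3 * (F.L : ℝ) ^ (j + 1) →
      2 * 10 ^ 14 * (F.L : ℝ) * (4 * (F.L : ℝ) ^ j * (2 * s + 2 * X * regThreshold F n K e)) ≤ 1 := by
    intro j hj X hX0 hX
    have hLj : (F.L : ℝ) ^ j ≤ (F.L : ℝ) ^ (K - n) := pow_le_pow_right₀ hL1 hj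
    have hLj0 : 0 ≤ (F.L : ℝ) ^ j := by positivity
    have h1 : (F.L : ℝ) * (F.L : ℝ) ^ j * s ≤ (F.L : ℝ) * (((F.L : ℝ) ^ (K - n)) * s) := by
      rw [mul_assoc]; exact mul_le_mul_of_nonneg_left (mul_le_mul_of_nonneg_right hLj hs0) hL0.le
    have hP : (F.L : ℝ) * (F.L : ℝ) ^ j * X ≤ 3 * (F.L : ℝ) ^ 2 * ((F.L : ℝ) ^ (K - n)) ^ 2 := by
      have hX' : X ≤ 3 * ((F.L : ℝ) * (F.L : ℝ) ^ (K - n)) := by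
        refine hX.trans ?_; rw [pow_succ']; nlinarith
      calc (F.L : ℝ) * (F.L : ℝ) ^ j * X ≤ (F.L : ℝ) * (F.L : ℝ) ^ (K - n) * (3 * ((F.L : ℝ) * (F.L : ℝ) ^ (K - n))) := by gcongr
        _ = 3 * (F.L : ℝ) ^ 2 * ((F.L : ℝ) ^ (K - n)) ^ 2 := by ring
    have h2 : (F.L : ℝ) * (F.L : ℝ) ^ j * X * regThreshold F n K e ≤ 3 * ((F.L : ℝ) ^ 2 * e) := by
      rw [hreg']
      have hone : ((F.L : ℝ) ^ (K - n)) ^ 2 * ((((F.L : ℝ)) ^ (K - n))⁻¹) ^ 2 = 1 := by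
        rw [← mul_pow, mul_inv_cancel₀ (by positivity), one_pow]
      have he2 : 0 ≤ e * ((((F.L : ℝ)) ^ (K - n))⁻¹) ^ 2 := by positivity
      calc (F.L : ℝ) * (F.L : ℝ) ^ j * X * (e * ((((F.L : ℝ)) ^ (K - n))⁻¹) ^ 2)
          ≤ 3 * (F.L : ℝ) ^ 2 * ((F.L : ℝ) ^ (K - n)) ^ 2 * (e * ((((F.L : ℝ)) ^ (K - n))⁻¹) ^ 2) := mul_le_mul_of_nonneg_right hP he2
        _ = 3 * ((F.L : ℝ) ^ 2 * e) * (((F.L : ℝ) ^ (K - n)) ^ 2 * ((((F.L : ℝ)) ^ (K - n))⁻¹) ^ 2) := by ring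
        _ = 3 * ((F.L : ℝ) ^ 2 * e) := by rw [hone, mul_one]
    have hexp : 2 * 10 ^ 14 * (F.L : ℝ) * (4 * (F.L : ℝ) ^ j * (2 * s + 2 * X * regThreshold F n K e))
        = 16 * 10 ^ 14 * ((F.L : ℝ) * (F.L : ℝ) ^ j * s) + 16 * 10 ^ 14 * ((F.L : ℝ) * (F.L : ℝ) ^ j * X * regThreshold F n K e) := by ring
    rw [hexp]
    linarith
  refine ⟨?_, ?_⟩
  · intro j hj b
    have hjm : j < (F.P K).m + (F.P K).K := by show j < F.m + K; omega
    have h := Prop7FibreLevelSupRowsT3.norm_pertVar_iter_le_of_plaqBound_T3 F K hjm b (emb15 W (expHermField D)) W hρ0 hδ0 hU hρ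
      (hnum j hj (2 * (F.L : ℝ) ^ j) (by positivity) (by rw [pow_succ']; nlinarith [pow_nonneg hL0.le j]))
    refine h.trans (le_of_eq ?_)
    rw [hd, hPL]; push_cast; ring
  · intro j hj c
    have hjm : j + 1 < (F.P K).m + (F.P K).K := by show j + 1 < F.m + K; omega
    have h := Prop7FibreLevelSupRowsT3.twoBlockMass_le_of_plaqBound_T3 F K hjm c (emb15 W (expHermField D)) W hρ0 hδ0 hU hρ
      (hnum j hj.le (3 * (F.L : ℝ) ^ (j + 1)) (by positivity) le_rfl)
    refine h.trans (le_of_eq ?_)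
    rw [Prop7FibreLevelSupRowsT3.mu_letter_T3 F K j (2 * s), hd]
    push_cast; rw [hPL]; ring


/-! ## §3 Numerals of the sup rows; the `𝔰𝔲(2)` rows of the log-ratio tower and of its sources -/

set_option maxHeartbeats 400000 in
/-- **NUMERALS OF THE SUP ROWS** (pure arithmetic in `L ≥ 3`, `s ≥ 0`, window `4·10¹¹L⁹(ℓs) ≤ 1`): the per-bond sups `16Lʲs` are inside the `SU(2)` log chart
(`< δ = 1∕3`) for `j ≤ K − n`; the two-block masses `μ_j = 480L⁴Lʲs` satisfy `72μ_j ≤ 1`, `3μ_j + 1∕24 < δ` and the (B6)-shape `7800L³ℓμ_j ≤ θLʲ` with `θ = 3744000·L⁷·(ℓs)`,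
`1000θL ≤ 1` — the `hμ72 ∕ hμN ∕ hμθ ∕ hθL` binders of ✓ `Prop7FibreLevelMassPerLevelT3.sum_normSq_levelRatio_le_LOnly_T3` and the guards of
✓ `Prop7LogRemainderMass.sum_norm_logRemainder_le_mass`. [cite: Balaban1985Averaging, Prop. 4 (134)-(135) p.38; Balaban1985BackgroundPropagators, Thm 3.11 p.416] -/
theorem supNumerals (F : T3Family) (n K : ℕ) {s : ℝ} (hs0 : 0 ≤ s) (hsL : 400000000000 * (F.L : ℝ) ^ 9 * (((F.L : ℝ) ^ (K - n)) * s) ≤ 1) :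
    (∀ j ≤ K - n, 16 * (F.L : ℝ) ^ j * s < deltaSU (Fin 2)) ∧
    (∀ j < K - n, 0 ≤ 480 * (F.L : ℝ) ^ 4 * (F.L : ℝ) ^ j * s) ∧
    (∀ j < K - n, 72 * (480 * (F.L : ℝ) ^ 4 * (F.L : ℝ) ^ j * s) ≤ 1) ∧
    (∀ j < K - n, 3 * (480 * (F.L : ℝ) ^ 4 * (F.L : ℝ) ^ j * s) + 1 / 24 < deltaSU (Fin 2)) ∧
    (∀ j < K - n, 7800 * (F.L : ℝ) ^ 3 * (F.L : ℝ) ^ (K - n) * (480 * (F.L : ℝ) ^ 4 * (F.L : ℝ) ^ j * s)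
        ≤ (3744000 * (F.L : ℝ) ^ 7 * (((F.L : ℝ) ^ (K - n)) * s)) * (F.L : ℝ) ^ j) ∧
    0 ≤ 3744000 * (F.L : ℝ) ^ 7 * (((F.L : ℝ) ^ (K - n)) * s) ∧
    1000 * (3744000 * (F.L : ℝ) ^ 7 * (((F.L : ℝ) ^ (K - n)) * s)) * (F.L : ℝ) ≤ 1 := by
  have hL3 : (3 : ℝ) ≤ (F.L : ℝ) := three_le_L F
  have hL0 : (0 : ℝ) < (F.L : ℝ) := by linarith
  have hL1 : (1 : ℝ) ≤ (F.L : ℝ) := by linarith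
  have hδ : deltaSU (Fin 2) = 1 / 3 := by
    unfold deltaSU
    rw [Fintype.card_fin]
    refine min_eq_left ?_
    rw [le_div_iff₀ (by norm_num)]
    have := Real.pi_gt_three; push_cast; linarith
  have hL8 : (6561 : ℝ) ≤ (F.L : ℝ) ^ 8 := by
    have := pow_le_pow_left₀ (by norm_num : (0:ℝ) ≤ 3) hL3 8
    norm_num at this; exact this
  have hℓs0 : 0 ≤ ((F.L : ℝ) ^ (K - n)) * s := by positivity
  -- `4·10¹¹·6561·L·(ℓ s) ≤ 1`
  have hA : 4 * 10 ^ 11 * 6561 * ((F.L : ℝ) * (((F.L : ℝ) ^ (K - n)) * s)) ≤ 1 := by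
    have h9 : (F.L : ℝ) ^ 9 * (((F.L : ℝ) ^ (K - n)) * s) = (F.L : ℝ) ^ 8 * ((F.L : ℝ) * (((F.L : ℝ) ^ (K - n)) * s)) := by ring
    rw [mul_assoc, h9] at hsL
    have h0 : 0 ≤ (F.L : ℝ) * (((F.L : ℝ) ^ (K - n)) * s) := by positivity
    nlinarith [mul_le_mul_of_nonneg_right hL8 h0]
  have hℓs : 4 * 10 ^ 11 * 19683 * (((F.L : ℝ) ^ (K - n)) * s) ≤ 1 := by nlinarith
  -- per level: `Lʲ ≤ ℓ` for `j ≤ K − n`, `L·Lʲ ≤ ℓ` for `j < K − n`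
  have hLj : ∀ j ≤ K - n, (F.L : ℝ) ^ j * s ≤ ((F.L : ℝ) ^ (K - n)) * s := fun j hj =>
    mul_le_mul_of_nonneg_right (pow_le_pow_right₀ hL1 hj) hs0
  have hLj1 : ∀ j < K - n, (F.L : ℝ) * (F.L : ℝ) ^ j * s ≤ ((F.L : ℝ) ^ (K - n)) * s := fun j hj => by
    rw [← pow_succ']; exact mul_le_mul_of_nonneg_right (pow_le_pow_right₀ hL1 (by omega)) hs0
  have hL30 : 0 ≤ (F.L : ℝ) ^ 3 := by positivity
  refine ⟨fun j hj => ?_, fun j hj => by positivity, fun j hj => ?_, fun j hj => ?_, fun j hj => le_of_eq (by ring), by positivity, ?_⟩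
  · rw [hδ]; nlinarith [hLj j hj]
  · have e1 : 72 * (480 * (F.L : ℝ) ^ 4 * (F.L : ℝ) ^ j * s) = 34560 * (F.L : ℝ) ^ 3 * ((F.L : ℝ) * (F.L : ℝ) ^ j * s) := by ring
    rw [e1]
    have := mul_le_mul_of_nonneg_left (hLj1 j hj) hL30
    have hL3ℓ : (F.L : ℝ) ^ 3 * (((F.L : ℝ) ^ (K - n)) * s) ≤ (F.L : ℝ) ^ 8 * (((F.L : ℝ) ^ (K - n)) * s) :=
      mul_le_mul_of_nonneg_right (pow_le_pow_right₀ hL1 (by norm_num)) hℓs0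
    have h9 : (F.L : ℝ) ^ 9 * (((F.L : ℝ) ^ (K - n)) * s) = (F.L : ℝ) * ((F.L : ℝ) ^ 8 * (((F.L : ℝ) ^ (K - n)) * s)) := by ring
    rw [mul_assoc, h9] at hsL
    nlinarith [mul_le_mul_of_nonneg_right hL1 (show 0 ≤ (F.L : ℝ) ^ 8 * (((F.L : ℝ) ^ (K - n)) * s) by positivity)]
  · rw [hδ]
    have e1 : 3 * (480 * (F.L : ℝ) ^ 4 * (F.L : ℝ) ^ j * s) = 1440 * (F.L : ℝ) ^ 3 * ((F.L : ℝ) * (F.L : ℝ) ^ j * s) := by ring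
    rw [e1]
    have := mul_le_mul_of_nonneg_left (hLj1 j hj) hL30
    have hL3ℓ : (F.L : ℝ) ^ 3 * (((F.L : ℝ) ^ (K - n)) * s) ≤ (F.L : ℝ) ^ 8 * (((F.L : ℝ) ^ (K - n)) * s) :=
      mul_le_mul_of_nonneg_right (pow_le_pow_right₀ hL1 (by norm_num)) hℓs0
    have h9 : (F.L : ℝ) ^ 9 * (((F.L : ℝ) ^ (K - n)) * s) = (F.L : ℝ) * ((F.L : ℝ) ^ 8 * (((F.L : ℝ) ^ (K - n)) * s)) := by ring
    rw [mul_assoc, h9] at hsL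
    nlinarith [mul_le_mul_of_nonneg_right hL1 (show 0 ≤ (F.L : ℝ) ^ 8 * (((F.L : ℝ) ^ (K - n)) * s) by positivity)]
  · have e1 : 1000 * (3744000 * (F.L : ℝ) ^ 7 * (((F.L : ℝ) ^ (K - n)) * s)) * (F.L : ℝ) = 3744000000 * ((F.L : ℝ) ^ 8 * (((F.L : ℝ) ^ (K - n)) * s)) := by ring
    rw [e1]
    have h9 : (F.L : ℝ) ^ 9 * (((F.L : ℝ) ^ (K - n)) * s) = (F.L : ℝ) * ((F.L : ℝ) ^ 8 * (((F.L : ℝ) ^ (K - n)) * s)) := by ring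
    rw [mul_assoc, h9] at hsL
    nlinarith [mul_le_mul_of_nonneg_right hL1 (show 0 ≤ (F.L : ℝ) ^ 8 * (((F.L : ℝ) ^ (K - n)) * s) by positivity)]

set_option maxHeartbeats 400000 in
/-- **THE `𝔰𝔲(2)` ROWS OF THE LOG-RATIO TOWER AND OF ITS SOURCES** at a chart point `W′ = e^{iD}W` of a (14)-regular `W` (inputs of ✓ `Prop7TrueLinRealityFamilies.su_sourcedReduced`
∕ `su_coarseGauge` — ★p1 g14's F0): (a) the level log-ratios `X_j(b) = mlog(Y_j(b) + 1)` are skew-Hermitian traceless for `j ≤ K − n` (✓ `su_mlog_pertVar_add_one`, sup `16Lʲs < 1∕3`);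
(b) the sources `R_j(c) = X_{j+1}(c) − T_jX_j(c)` are skew-Hermitian traceless for `j < K − n` (✓ `su_trueLin` under the loop sizes of §1, ✓ `su_sub`); (c) so is
`X_0(b) − iD(b)` (the `D₀` of the sourced reduced family; `iD` skew-Hermitian traceless for Hermitian traceless `D`).
[cite: Balaban1985Averaging, Prop. 3 (122)-(126) p.36; Balaban1985Variational, (15) p.280, (112) p.294] -/
theorem suRows (F : T3Family) (n K : ℕ) {e s : ℝ} (he : 0 < e) (heL : 100000000000000 * (F.L : ℝ) ^ 9 * e ≤ 1)
    (hs0 : 0 ≤ s) (hs4 : 4 * s ≤ 1) (hsL : 400000000000 * (F.L : ℝ) ^ 9 * (((F.L : ℝ) ^ (K - n)) * s) ≤ 1)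
    {W : GaugeField (F.P K) 0 (Matrix.specialUnitaryGroup (Fin 2) ℂ)} (hreg : RegPr F n K e W)
    (D : PBond (F.P K) 0 → Matrix (Fin 2) (Fin 2) ℂ) (hD : ∀ b : PBond (F.P K) 0, (D b).IsHermitian ∧ Matrix.trace (D b) = 0)
    (hs : ∀ b : PBond (F.P K) 0, ‖D b‖ ≤ s) :
    (∀ j ≤ K - n, ∀ b : PBond (F.P K) j,
        star (mlog (pertVar (Averaging.iter (fun i => blockAvg (P := F.P K) (j := i) (expMeanLogSU (n := Fin 2))) j W) (Averaging.iter (fun i => blockAvg (P := F.P K) (j := i) (expMeanLogSU (n := Fin 2))) j (emb15 W (expHermField D))) b + 1)) = -mlog (pertVar (Averaging.iter (fun i => blockAvg (P := F.P K) (j := i) (expMeanLogSU (n := Fin 2))) j W) (Averaging.iter (fun i => blockAvg (P := F.P K) (j := i) (expMeanLogSU (n := Fin 2))) j (emb15 W (expHermField D))) b + 1) ∧ (mlog (pertVar (Averaging.iter (fun i => blockAvg (P := F.P K) (j := i) (expMeanLogSU (n := Fin 2))) j W) (Averaging.iter (fun i => blockAvg (P := F.P K) (j := i) (expMeanLogSU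 (n := Fin 2))) j (emb15 W (expHermField D))) b + 1)).trace = 0) ∧
    (∀ j < K - n, ∀ c : PBond (F.P K) (j + 1),
        star (mlog (pertVar (Averaging.iter (fun i => blockAvg (P := F.P K) (j := i) (expMeanLogSU (n := Fin 2))) (j + 1) W) (Averaging.iter (fun i => blockAvg (P := F.P K) (j := i) (expMeanLogSU (n := Fin 2))) (j + 1) (emb15 W (expHermField D))) c + 1)
        - (fderiv ℂ (eml : (Idx (F.P K) → Matrix (Fin 2) (Fin 2) ℂ) → Matrix (Fin 2) (Fin 2) ℂ) (fun i => ((loopHol (Averaging.iter (fun i => blockAvg (P := F.P K) (j := i) (expMeanLogSU (n := Fin 2))) j W) c i : Matrix.specialUnitaryGroup (Fin 2) ℂ) : Matrix (Fin 2) (Fin 2) ℂ))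
            (fun i => covWalkSum (Averaging.iter (fun i => blockAvg (P := F.P K) (j := i) (expMeanLogSU (n := Fin 2))) j W) (fun b => mlog (pertVar (Averaging.iter (fun i => blockAvg (P := F.P K) (j := i) (expMeanLogSU (n := Fin 2))) j W) (Averaging.iter (fun i => blockAvg (P := F.P K) (j := i) (expMeanLogSU (n := Fin 2))) j (emb15 W (expHermField D))) b + 1)) (walk (emb c.src) (loopWord (F.P K).L c.dir (off i.1) i.2.1 i.2.2)) * ((loopHol (Averaging.iter (fun i => blockAvg (P := F.P K) (j := i) (expMeanLogSU (n := Fin 2))) j W) c i : Matrix.specialUnitaryGroup (Fin 2) ℂ) : Matrix (Fin 2) (Fin 2) ℂ))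
            * star ((corr (expMeanLogSU (n := Fin 2)) (Averaging.iter (fun i => blockAvg (P := F.P K) (j := i) (expMeanLogSU (n := Fin 2))) j W) c : Matrix.specialUnitaryGroup (Fin 2) ℂ) : Matrix (Fin 2) (Fin 2) ℂ)
          + ((corr (expMeanLogSU (n := Fin 2)) (Averaging.iter (fun i => blockAvg (P := F.P K) (j := i) (expMeanLogSU (n := Fin 2))) j W) c : Matrix.specialUnitaryGroup (Fin 2) ℂ) : Matrix (Fin 2) (Fin 2) ℂ)
            * covWalkSum (Averaging.iter (fun i => blockAvg (P := F.P K) (j := i) (expMeanLogSU (n := Fin 2))) j W) (fun b => mlog (pertVar (Averaging.iter (fun i => blockAvg (P := F.P K) (j := i) (expMeanLogSU (n := Fin 2))) j W) (Averaging.iter (fun i => blockAvg (P := F.P K) (j := i) (expMeanLogSU (n := Fin 2))) j (emb15 W (expHermField D))) b + 1)) (walk (emb c.src) (List.replicate (F.P K).L (c.dir, true)))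
            * star ((corr (expMeanLogSU (n := Fin 2)) (Averaging.iter (fun i => blockAvg (P := F.P K) (j := i) (expMeanLogSU (n := Fin 2))) j W) c : Matrix.specialUnitaryGroup (Fin 2) ℂ) : Matrix (Fin 2) (Fin 2) ℂ)))
          = -(mlog (pertVar (Averaging.iter (fun i => blockAvg (P := F.P K) (j := i) (expMeanLogSU (n := Fin 2))) (j + 1) W) (Averaging.iter (fun i => blockAvg (P := F.P K) (j := i) (expMeanLogSU (n := Fin 2))) (j + 1) (emb15 W (expHermField D))) c + 1)
        - (fderiv ℂ (eml : (Idx (F.P K) → Matrix (Fin 2) (Fin 2) ℂ) → Matrix (Fin 2) (Fin 2) ℂ) (fun i => ((loopHol (Averaging.iter (fun i => blockAvg (P := F.P K) (j := i) (expMeanLogSU (n := Fin 2))) j W) c i : Matrix.specialUnitaryGroup (Fin 2) ℂ) : Matrix (Fin 2) (Fin 2) ℂ))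
            (fun i => covWalkSum (Averaging.iter (fun i => blockAvg (P := F.P K) (j := i) (expMeanLogSU (n := Fin 2))) j W) (fun b => mlog (pertVar (Averaging.iter (fun i => blockAvg (P := F.P K) (j := i) (expMeanLogSU (n := Fin 2))) j W) (Averaging.iter (fun i => blockAvg (P := F.P K) (j := i) (expMeanLogSU (n := Fin 2))) j (emb15 W (expHermField D))) b + 1)) (walk (emb c.src) (loopWord (F.P K).L c.dir (off i.1) i.2.1 i.2.2)) * ((loopHol (Averaging.iter (fun i => blockAvg (P := F.P K) (j := i) (expMeanLogSU (n := Fin 2))) j W) c i : Matrix.specialUnitaryGroup (Fin 2) ℂ) : Matrix (Fin 2) (Fin 2) ℂ))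
            * star ((corr (expMeanLogSU (n := Fin 2)) (Averaging.iter (fun i => blockAvg (P := F.P K) (j := i) (expMeanLogSU (n := Fin 2))) j W) c : Matrix.specialUnitaryGroup (Fin 2) ℂ) : Matrix (Fin 2) (Fin 2) ℂ)
          + ((corr (expMeanLogSU (n := Fin 2)) (Averaging.iter (fun i => blockAvg (P := F.P K) (j := i) (expMeanLogSU (n := Fin 2))) j W) c : Matrix.specialUnitaryGroup (Fin 2) ℂ) : Matrix (Fin 2) (Fin 2) ℂ)
            * covWalkSum (Averaging.iter (fun i => blockAvg (P := F.P K) (j := i) (expMeanLogSU (n := Fin 2))) j W) (fun b => mlog (pertVar (Averaging.iter (fun i => blockAvg (P := F.P K) (j := i) (expMeanLogSU (n := Fin 2))) j W) (Averaging.iter (fun i => blockAvg (P := F.P K) (j := i) (expMeanLogSU (n := Fin 2))) j (emb15 W (expHermField D))) b + 1)) (walk (emb c.src) (List.replicate (F.P K).L (c.dir, true)))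
            * star ((corr (expMeanLogSU (n := Fin 2)) (Averaging.iter (fun i => blockAvg (P := F.P K) (j := i) (expMeanLogSU (n := Fin 2))) j W) c : Matrix.specialUnitaryGroup (Fin 2) ℂ) : Matrix (Fin 2) (Fin 2) ℂ))) ∧
        (mlog (pertVar (Averaging.iter (fun i => blockAvg (P := F.P K) (j := i) (expMeanLogSU (n := Fin 2))) (j + 1) W) (Averaging.iter (fun i => blockAvg (P := F.P K) (j := i) (expMeanLogSU (n := Fin 2))) (j + 1) (emb15 W (expHermField D))) c + 1)
        - (fderiv ℂ (eml : (Idx (F.P K) → Matrix (Fin 2) (Fin 2) ℂ) → Matrix (Fin 2) (Fin 2) ℂ) (fun i => ((loopHol (Averaging.iter (fun i => blockAvg (P := F.P K) (j := i) (expMeanLogSU (n := Fin 2))) j W) c i : Matrix.specialUnitaryGroup (Fin 2) ℂ) : Matrix (Fin 2) (Fin 2) ℂ))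
            (fun i => covWalkSum (Averaging.iter (fun i => blockAvg (P := F.P K) (j := i) (expMeanLogSU (n := Fin 2))) j W) (fun b => mlog (pertVar (Averaging.iter (fun i => blockAvg (P := F.P K) (j := i) (expMeanLogSU (n := Fin 2))) j W) (Averaging.iter (fun i => blockAvg (P := F.P K) (j := i) (expMeanLogSU (n := Fin 2))) j (emb15 W (expHermField D))) b + 1)) (walk (emb c.src) (loopWord (F.P K).L c.dir (off i.1) i.2.1 i.2.2)) * ((loopHol (Averaging.iter (fun i => blockAvg (P := F.P K) (j := i) (expMeanLogSU (n := Fin 2))) j W) c i : Matrix.specialUnitaryGroup (Fin 2) ℂ) : Matrix (Fin 2) (Fin 2) ℂ))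
            * star ((corr (expMeanLogSU (n := Fin 2)) (Averaging.iter (fun i => blockAvg (P := F.P K) (j := i) (expMeanLogSU (n := Fin 2))) j W) c : Matrix.specialUnitaryGroup (Fin 2) ℂ) : Matrix (Fin 2) (Fin 2) ℂ)
          + ((corr (expMeanLogSU (n := Fin 2)) (Averaging.iter (fun i => blockAvg (P := F.P K) (j := i) (expMeanLogSU (n := Fin 2))) j W) c : Matrix.specialUnitaryGroup (Fin 2) ℂ) : Matrix (Fin 2) (Fin 2) ℂ)
            * covWalkSum (Averaging.iter (fun i => blockAvg (P := F.P K) (j := i) (expMeanLogSU (n := Fin 2))) j W) (fun b => mlog (pertVar (Averaging.iter (fun i => blockAvg (P := F.P K) (j := i) (expMeanLogSU (n := Fin 2))) j W) (Averaging.iter (fun i => blockAvg (P := F.P K) (j := i) (expMeanLogSU (n := Fin 2))) j (emb15 W (expHermField D))) b + 1)) (walk (emb c.src) (List.replicate (F.P K).L (c.dir, true)))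
            * star ((corr (expMeanLogSU (n := Fin 2)) (Averaging.iter (fun i => blockAvg (P := F.P K) (j := i) (expMeanLogSU (n := Fin 2))) j W) c : Matrix.specialUnitaryGroup (Fin 2) ℂ) : Matrix (Fin 2) (Fin 2) ℂ))).trace = 0) ∧
    (∀ b : PBond (F.P K) 0, star (mlog (pertVar W (emb15 W (expHermField D)) b + 1) - Complex.I • D b) = -(mlog (pertVar W (emb15 W (expHermField D)) b + 1) - Complex.I • D b) ∧
        (mlog (pertVar W (emb15 W (expHermField D)) b + 1) - Complex.I • D b).trace = 0) := by
  have heL' : 1000000 * (F.L : ℝ) ^ 5 * e ≤ 1 := by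
    have hL3 : (3 : ℝ) ≤ (F.L : ℝ) := three_le_L F
    have hL1 : (1 : ℝ) ≤ (F.L : ℝ) := by linarith
    have h59 : (F.L : ℝ) ^ 5 ≤ (F.L : ℝ) ^ 9 := pow_le_pow_right₀ hL1 (by norm_num)
    nlinarith [pow_nonneg (show (0:ℝ) ≤ F.L by linarith) 5, he.le]
  obtain ⟨hα, -, -, hαN, -⟩ := levelSizes_of_regPr F n K he heL' hreg
  obtain ⟨hsup, -⟩ := chartSups F n K he heL hs0 hs4 hsL hreg D hD hs
  obtain ⟨hδj, -⟩ := supNumerals F n K hs0 hsL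
  have hX : ∀ j ≤ K - n, ∀ b : PBond (F.P K) j,
      star (mlog (pertVar (Averaging.iter (fun i => blockAvg (P := F.P K) (j := i) (expMeanLogSU (n := Fin 2))) j W) (Averaging.iter (fun i => blockAvg (P := F.P K) (j := i) (expMeanLogSU (n := Fin 2))) j (emb15 W (expHermField D))) b + 1)) = -mlog (pertVar (Averaging.iter (fun i => blockAvg (P := F.P K) (j := i) (expMeanLogSU (n := Fin 2))) j W) (Averaging.iter (fun i => blockAvg (P := F.P K) (j := i) (expMeanLogSU (n := Fin 2))) j (emb15 W (expHermField D))) b + 1) ∧ (mlog (pertVar (Averaging.iter (fun i => blockAvg (P := F.P K) (j := i) (expMeanLogSU (n := Fin 2))) j W) (Averaging.iter (fun i => blockAvg (P := F.P K) (j := i) (expMeanLogSU (n := Fin 2))) j (emb15 W (expHermField D))) b + 1)).trace = 0 :=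
    fun j hj b => Prop7TrueLinRealityFamilies.su_mlog_pertVar_add_one _ _ b ((hsup j hj b).trans_lt (hδj j hj))
  refine ⟨hX, fun j hj c => ?_, fun b => ?_⟩
  · have hsmall : ∀ i : Idx (F.P K), dist1 (loopHol (Averaging.iter (fun i => blockAvg (P := F.P K) (j := i) (expMeanLogSU (n := Fin 2))) j W) c i) < deltaSU (Fin 2) :=
      fun i => (hα j hj c i).trans_lt (hαN j hj)
    exact Prop7TrueLinReality.su_sub (hX (j + 1) (by omega) c)
      (Prop7TrueLinReality.su_trueLin (Averaging.iter (fun i => blockAvg (P := F.P K) (j := i) (expMeanLogSU (n := Fin 2))) j W) (fun b => hX j hj.le b) c hsmall)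
  · have h0 : ‖pertVar W (emb15 W (expHermField D)) b‖ < deltaSU (Fin 2) := by
      have h1 := Prop7HessWOfFibreCoreT3Rows.norm_pertVar_expChart_le W D b (hD b) ((hs b).trans (by linarith))
      have h2 := hδj 0 (Nat.zero_le _)
      rw [pow_zero, mul_one] at h2
      linarith [hs b]
    have hID : star (Complex.I • D b) = -(Complex.I • D b) ∧ (Complex.I • D b).trace = 0 := by
      refine ⟨?_, ?_⟩
      · rw [star_smul, Complex.star_def, Complex.conj_I, Matrix.star_eq_conjTranspose, (hD b).1.eq, neg_smul]
      · rw [Matrix.trace_smul, (hD b).2, smul_zero]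
    exact Prop7TrueLinReality.su_sub (Prop7TrueLinRealityFamilies.su_mlog_pertVar_add_one _ _ b h0) hID

end Summit.QuantumFields.YangMills.Theorems.Prop7JointRowTowerData

end
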